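import Mathlib
import HarnessLib
import Literature.MathematicalPhysics.QuantumFieldTheory.ConstructiveQFTWave0
import Summits.Ventures.LatticeQCDFlow.Scaling.Conjectures
import Summits.Ventures.LatticeQCDFlow.Scaling.ExactTransportUN
import Summits.Ventures.LatticeQCDFlow.Scaling.ExactTransportSUN

/-!
# LatticeQCDFlow / Scaling — depth of an exact layered flow grows linearly in `β` (v2.5)

HONEST FRAMING: exact (Metropolis-corrected) sampling algorithms for lattice gauge theory; figures
of merit are autocorrelation/cost numbers at stated couplings and volumes; no continuum-physics
claim.

Venture `LatticeQCDFlow` (cell pub-lqcd), topic `Scaling`, FANOUT row 29 (theory2) — OUR WORK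
(THEORY-2.md v2.5 §3.3, row C2a: the ARCHITECTURE-LEVEL reading of transport rigidity).
A flow architecture is a composite `T = T₁ ∘ ⋯ ∘ Tₙ` of `n` layers (coupling layers, residual
blocks, gauge-equivariant link updates, …), each of bi-Lipschitz distortion at most `Λ·Λ'`
(`LipschitzWith Λ Tᵢ`, `AntilipschitzWith Λ' Tᵢ`) for the sup metric on configurations.
Bi-Lipschitz constants multiply under composition (`lipschitzWith_compLayers`,
`antilipschitzWith_compLayers`; heterogeneous stacks `lipschitzWith_compLayers_prod`,
`antilipschitzWith_compLayers_prod`, law `exp_le_prod_distortion_of_exactTransport`: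
`∏ᵢ Λᵢ·Λ'ᵢ ≥ e^{cβ}`), so the transport-rigidity statement (C2a)
`Conjectures.ExactTransportBiLipschitz` (`e^{cβ} ≤ K·K'` for every EXACT transport of `⊗Haar`
onto the Wilson law, `c` independent of the volume) forces
`c·β ≤ n · log(Λ·Λ')` — **the number of layers of an exact flow of bounded per-layer distortion
grows at least linearly in the coupling `β`, uniformly in the volume `L`**
(`layerDepthLaw_of_exactTransport`; for `Λ·Λ' ≤ 1` there is no exact flow at all at `β > 0`).
UNCONDITIONAL instances from row 30's theorems `UN.exactTransportBiLipschitz`,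
`SUN.exactTransportBiLipschitz`: `U(N)` and `SU(N)`, `N ≥ 2`, `d ≥ 2`, Hilbert–Schmidt metric
(`UN.layerDepthLaw`, `SUN.layerDepthLaw`; `SU(3)`, `d = 4` included).  This is a statement about
EXACT flows (the sampler's proposal pushed forward equals the target); the open content for
`ε`-accurate flows is conjecture C2b (THEORY-2.md §3.3), untouched here.  Elementary; nothing is
cited as a fact.
-/

noncomputable section

open MeasureTheory Literature.MathematicalPhysics.QuantumFieldTheory

namespace Summit.Ventures.LatticeQCDFlow.Theory2.Lattice

/-! ## §1. Bi-Lipschitz constants multiply along a stack of layers -/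

section Layers

variable {X : Type*}

/-- The composite of a stack of layers (`[T₁, …, Tₙ] ↦ T₁ ∘ ⋯ ∘ Tₙ`). -/
def compLayers (l : List (X → X)) : X → X := l.foldr (fun T S => T ∘ S) id

/-- The empty stack is the identity. -/
theorem compLayers_nil : compLayers ([] : List (X → X)) = id := rfl

/-- Adding a layer on top composes on the left. -/
theorem compLayers_cons (T : X → X) (l : List (X → X)) :
    compLayers (T :: l) = T ∘ compLayers l := rfl

variable [PseudoEMetricSpace X]

/-- `n` layers, each `Λ`-Lipschitz, compose to a `Λⁿ`-Lipschitz map. [folklore] -/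
theorem lipschitzWith_compLayers {Λ : NNReal} :
    ∀ l : List (X → X), (∀ T ∈ l, LipschitzWith Λ T) →
      LipschitzWith (Λ ^ l.length) (compLayers l)
  | [], _ => by
      rw [List.length_nil, pow_zero, compLayers_nil]
      exact LipschitzWith.id
  | T :: l, h => by
      rw [compLayers_cons, List.length_cons, pow_succ']
      exact (h T (by simp)).comp (lipschitzWith_compLayers l fun S hS => h S (by simp [hS]))

/-- `n` layers, each `Λ'`-antilipschitz, compose to a `Λ'ⁿ`-antilipschitz map. [folklore] -/
theorem antilipschitzWith_compLayers {Λ' : NNReal} :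
    ∀ l : List (X → X), (∀ T ∈ l, AntilipschitzWith Λ' T) →
      AntilipschitzWith (Λ' ^ l.length) (compLayers l)
  | [], _ => by
      rw [List.length_nil, pow_zero, compLayers_nil]
      exact AntilipschitzWith.id
  | T :: l, h => by
      rw [compLayers_cons, List.length_cons, pow_succ]
      exact (h T (by simp)).comp (antilipschitzWith_compLayers l fun S hS => h S (by simp [hS]))

/-- Heterogeneous stack: layers `Tᵢ` with their own Lipschitz constants `Λᵢ` compose to a
`∏ Λᵢ`-Lipschitz map (a layer is a triple `(T, Λ, Λ')`). [folklore] -/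
theorem lipschitzWith_compLayers_prod :
    ∀ l : List ((X → X) × NNReal × NNReal), (∀ t ∈ l, LipschitzWith t.2.1 t.1) →
      LipschitzWith (l.map fun t => t.2.1).prod (compLayers (l.map Prod.fst))
  | [], _ => by
      rw [List.map_nil, List.map_nil, List.prod_nil, compLayers_nil]
      exact LipschitzWith.id
  | t :: l, h => by
      rw [List.map_cons, List.map_cons, List.prod_cons, compLayers_cons]
      exact (h t (by simp)).comp
        (lipschitzWith_compLayers_prod l fun s hs => h s (by simp [hs]))

/-- Heterogeneous stack, expanding side: `∏ Λ'ᵢ`-antilipschitz. [folklore] -/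
theorem antilipschitzWith_compLayers_prod :
    ∀ l : List ((X → X) × NNReal × NNReal), (∀ t ∈ l, AntilipschitzWith t.2.2 t.1) →
      AntilipschitzWith (l.map fun t => t.2.2).prod (compLayers (l.map Prod.fst))
  | [], _ => by
      rw [List.map_nil, List.map_nil, List.prod_nil, compLayers_nil]
      exact AntilipschitzWith.id
  | t :: l, h => by
      rw [List.map_cons, List.map_cons, List.prod_cons, compLayers_cons, mul_comm]
      exact (h t (by simp)).comp
        (antilipschitzWith_compLayers_prod l fun s hs => h s (by simp [hs]))

end Layers

/-! ## §2. The layer-depth law -/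

section Law

variable (d N : ℕ) (G : Type) [Group G] [MetricSpace G] [IsTopologicalGroup G] [CompactSpace G]
  [MeasurableSpace G] [BorelSpace G] (ρ : G →* Matrix (Fin N) (Fin N) ℂ)

/-- **Layer-depth law.**  There are `c > 0` and `β₀` such that at every volume `L` and coupling
`β ≥ β₀`: if a stack of `n` layers, each `Λ`-Lipschitz and `Λ'`-antilipschitz for the sup metric,
transports the product Haar measure EXACTLY onto the Wilson measure, then
`c·β ≤ n · log(Λ·Λ')`.  A conjecture item exactly where (C2a) is one (general compact `G`);
a THEOREM for `U(N)`, `SU(N)`, `N ≥ 2`, `d ≥ 2` (§3). -/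
@[conjecture]
def LayerDepthLaw : Prop :=
  ∃ c : ℝ, 0 < c ∧ ∃ β₀ : ℝ, ∀ (L : ℕ) [NeZero L] (β : ℝ), β₀ ≤ β →
    ∀ (l : List (GaugeConfig d L G → GaugeConfig d L G)) (Λ Λ' : NNReal),
      (∀ T ∈ l, LipschitzWith Λ T) → (∀ T ∈ l, AntilipschitzWith Λ' T) →
      (Measure.pi fun _ : Edge d L => haarProbability G).map (compLayers l) =
          wilsonMeasure (d := d) (L := L) ρ β →
      c * β ≤ (l.length : ℝ) * Real.log ((Λ : ℝ) * Λ')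

variable {d N G ρ}

/-- **(C2a) ⇒ the layer-depth law** (same constants `c`, `β₀`): apply transport rigidity to the
composite, whose bi-Lipschitz constants are `Λⁿ`, `Λ'ⁿ`, and take logarithms. [folklore] -/
theorem layerDepthLaw_of_exactTransport (h : Conjectures.ExactTransportBiLipschitz d N G ρ) :
    LayerDepthLaw d N G ρ := by
  obtain ⟨c, hc, β₀, hβ⟩ := h
  refine ⟨c, hc, β₀, fun L _ β hβ₀ l Λ Λ' hΛ hΛ' hT => ?_⟩
  have h1 := hβ L β hβ₀ (compLayers l) (Λ ^ l.length) (Λ' ^ l.length)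
    (lipschitzWith_compLayers l hΛ) (antilipschitzWith_compLayers l hΛ') hT
  rw [NNReal.coe_pow, NNReal.coe_pow, ← mul_pow] at h1
  have h2 := Real.log_le_log (Real.exp_pos _) h1
  rwa [Real.log_exp, Real.log_pow] at h2

/-- **(C2a) ⇒ the distortion-budget law for heterogeneous stacks** (same `c`, `β₀`): an exact
transport realised by layers `(Tᵢ, Λᵢ, Λ'ᵢ)` has total distortion `∏ᵢ Λᵢ·Λ'ᵢ ≥ e^{cβ}`, i.e.
`Σᵢ log(Λᵢ·Λ'ᵢ) ≥ c·β`. [folklore] -/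
theorem exp_le_prod_distortion_of_exactTransport
    (h : Conjectures.ExactTransportBiLipschitz d N G ρ) :
    ∃ c : ℝ, 0 < c ∧ ∃ β₀ : ℝ, ∀ (L : ℕ) [NeZero L] (β : ℝ), β₀ ≤ β →
      ∀ l : List ((GaugeConfig d L G → GaugeConfig d L G) × NNReal × NNReal),
        (∀ t ∈ l, LipschitzWith t.2.1 t.1) → (∀ t ∈ l, AntilipschitzWith t.2.2 t.1) →
        (Measure.pi fun _ : Edge d L => haarProbability G).map (compLayers (l.map Prod.fst)) =
            wilsonMeasure (d := d) (L := L) ρ β →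
        Real.exp (c * β) ≤ ((l.map fun t => t.2.1 * t.2.2).prod : NNReal) := by
  obtain ⟨c, hc, β₀, hβ⟩ := h
  refine ⟨c, hc, β₀, fun L _ β hβ₀ l hΛ hΛ' hT => ?_⟩
  have h1 := hβ L β hβ₀ _ _ _ (lipschitzWith_compLayers_prod l hΛ)
    (antilipschitzWith_compLayers_prod l hΛ') hT
  rwa [← NNReal.coe_mul, ← List.prod_map_mul] at h1

/-- **No shallow miracle**: under (C2a), at `β ≥ β₀`, `β > 0`, a stack of layers of per-layer
distortion `Λ·Λ' ≤ 1` is never an exact transport. [folklore] -/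
theorem no_exact_stack_of_distortion_le_one (h : Conjectures.ExactTransportBiLipschitz d N G ρ) :
    ∃ β₀ : ℝ, ∀ (L : ℕ) [NeZero L] (β : ℝ), β₀ ≤ β → 0 < β →
      ∀ (l : List (GaugeConfig d L G → GaugeConfig d L G)) (Λ Λ' : NNReal),
        (∀ T ∈ l, LipschitzWith Λ T) → (∀ T ∈ l, AntilipschitzWith Λ' T) → (Λ : ℝ) * Λ' ≤ 1 →
        (Measure.pi fun _ : Edge d L => haarProbability G).map (compLayers l) ≠
          wilsonMeasure (d := d) (L := L) ρ β := by
  obtain ⟨c, hc, β₀, hβ⟩ := layerDepthLaw_of_exactTransport h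
  refine ⟨β₀, fun L _ β hβ₀ hβpos l Λ Λ' hΛ hΛ' hΛΛ' hT => ?_⟩
  have h1 := hβ L β hβ₀ l Λ Λ' hΛ hΛ' hT
  have h2 : Real.log ((Λ : ℝ) * Λ') ≤ 0 := Real.log_nonpos (by positivity) hΛΛ'
  have h3 : (l.length : ℝ) * Real.log ((Λ : ℝ) * Λ') ≤ 0 :=
    mul_nonpos_of_nonneg_of_nonpos (Nat.cast_nonneg _) h2
  have h4 : 0 < c * β := mul_pos hc hβpos
  linarith

end Law

/-! ## §3. Unconditional instances: `U(N)` and `SU(N)`, `N ≥ 2`, `d ≥ 2` -/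

open scoped Matrix.Norms.Frobenius
open Literature.MathematicalPhysics.QuantumFieldTheory.UnitaryCayley
  Literature.MathematicalPhysics.QuantumLattice

/-- **Layer-depth law for `U(N)`, `N ≥ 2`, `d ≥ 2`** (Hilbert–Schmidt metric), from row 30's
`UN.exactTransportBiLipschitz`. [folklore] -/
theorem UN.layerDepthLaw (d N : ℕ) (hd : 2 ≤ d) (hN : 2 ≤ N) :
    @LayerDepthLaw d N (𝔾 N) _ Subtype.metricSpace UN.isTopologicalGroup_hs UN.compactSpace_hs _
      UN.borelSpace_hs (unitaryFundamentalRep (Fin N) ℂ) :=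
  @layerDepthLaw_of_exactTransport d N (𝔾 N) _ Subtype.metricSpace UN.isTopologicalGroup_hs
    UN.compactSpace_hs _ UN.borelSpace_hs (unitaryFundamentalRep (Fin N) ℂ)
    (UN.exactTransportBiLipschitz d N hd hN)

/-- **Layer-depth law for `SU(N)`, `N ≥ 2`, `d ≥ 2`** (Hilbert–Schmidt metric; `SU(3)`, `d = 4`
included), from row 30's `SUN.exactTransportBiLipschitz`. [folklore] -/
theorem SUN.layerDepthLaw (d N : ℕ) (hd : 2 ≤ d) (hN : 2 ≤ N) :
    @LayerDepthLaw d N (Matrix.specialUnitaryGroup (Fin N) ℂ) _ Subtype.metricSpace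
      SUN.isTopologicalGroup_hs SUN.compactSpace_hs _ SUN.borelSpace_hs (fundamentalRep (Fin N)) :=
  @layerDepthLaw_of_exactTransport d N (Matrix.specialUnitaryGroup (Fin N) ℂ) _
    Subtype.metricSpace SUN.isTopologicalGroup_hs SUN.compactSpace_hs _ SUN.borelSpace_hs
    (fundamentalRep (Fin N)) (SUN.exactTransportBiLipschitz d N hd hN)

end Summit.Ventures.LatticeQCDFlow.Theory2.Lattice

end
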